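import Summits.Ventures.CertifiedManyBodySolver.Downfold.EmerySecularFormDefectAxial
import Summits.Ventures.CertifiedManyBodySolver.Downfold.EmeryFermiVelocityScaleIntervals
import HarnessLib

/-!
# The one-band form defect of the bilinear secular family, III: the kernel-decidable point check `fdCheck` — certified windows for
# the σ form defect `δ_σ̄` and the axial-slope sensitivity `κ` of a typed three-band set at its Fermi-energy bracket, and the
# four-orbital law `δ₄(a′) ∈ [δlo + a′κlo, δhi + a′κhi]`

Venture CertifiedManyBodySolver, cell `pub/hubbard-downfold` (stage S1), seat hubbard-downfold-mod-4 (technique B); namespace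
`Summit.Ventures.CertifiedManyBodySolver.Downfold.Emery`. Everything here is PROVED. WHAT THIS IS NOT: a statement about any material; no
number lives here; `U = 0` band kinematics.

For a σ one-body POINT `(Δ_pd, t_pd, t_pp, t_pp′) ∈ ℚ⁴` (the frozen O–O couplings, i.e. including any constant co-shift of record) and an
energy piece `[e₁, e₂] ∋ ε_F` (the certified Fermi-energy bracket of the census files `EmeryFermiScalePoints*`, theorems `scalePt_…_br`):

* interval images `ifsD1`, `ifsN1`, `iaxA`, `iaxB` (of `EmerySecularFormDefectAxial.axA/axB`), the nodal sum `isNode = fsD1/fsN1`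
  (`= 2x_node`, by the nodal decoupling `axialLin_node_eq_zero`), the face ordinate `iyFace = (cA − 4fsD)/(4fsD + 16fsN)`
  (`EmeryFermiFaceVelocity.face_contour_eq`), the energy derivatives `iPn = dcharA + dcharB·s_node`, `iPa = dcharA + dcharB·(1 + y_a)`, the
  axial coefficient at the antinode `iQa = axA + axB·(1 + y_a)`, and the windows `idelta = iPa/iPn − 1`, `ikappa = iQa/iPn` — all with the
  tree's `NonemptyInterval.mooreMul` / `divPos` (`EmeryFermiVelocityScaleIntervals`), inclusion-sound by construction;
* `fdCheck Δ a b c e₁ e₂ dlo dhi klo khi` — a plain conjunction of rational tests decided by `decide +kernel`; SOUNDNESS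
  `formDefect_of_fdCheck`: for every `ε ∈ [e₁, e₂]` and every nodal `(x_n, x_n)` / antinodal `(1, y_a)` point of the contour at `ε`:
  `∂_ε charCubic(node) > 0`, `axialLin(node) = 0`, `δ_σ̄ = ∂_ε charCubic(an)/∂_ε charCubic(node) − 1 ∈ [dlo, dhi]`,
  `κ = axialLin(an)/∂_ε charCubic(node) ∈ [klo, khi]`; and THE FOUR-ORBITAL LAW `formDefect4_of_fdCheck`: for every admixture slope
  `a′ ≥ 0`, `W4 a′ (an)/W4 a′ (node) − 1 ∈ [dlo + a′·klo, dhi + a′·khi]` (`formDefect4_linear`).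

By `EmerySecularFormDefect.formDefect_law_scales` these ratios ARE the one-band `t–t′` form defects `t_node/t_an − 1` of the σ set
(`a′ = 0`) and of every four-orbital decomposition of its O–O couplings with admixture slope `a′ = t_sp²/(ε_s − ε_F)²` at the same Fermi
surface. Sources: [HybertsenSchluterChristensen1989, Eq. (1)]; [AndersenEtAl1995, §6–§7]; interval arithmetic [folklore] (Moore 1966).
-/

noncomputable section

namespace Summit.Ventures.CertifiedManyBodySolver.Downfold.Emery

open Real Set NonemptyInterval

/-! ## §1 Interval images -/

/-- Image of `fsD1 = ε(Δ + ε)`. [folklore] -/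
def ifsD1 (IΔ Ie : NonemptyInterval ℚ) : NonemptyInterval ℚ := Ie.mooreMul (IΔ + Ie)

/-- Image of `fsN1 = 4t_pd² + 2ε(t_pp − t_pp′)`. [folklore] -/
def ifsN1 (Ia Ib Ic Ie : NonemptyInterval ℚ) : NonemptyInterval ℚ :=
  (NonemptyInterval.pure 4).mooreMul (Ia.moorePow 2) + ((NonemptyInterval.pure 2).mooreMul Ie).mooreMul (Ib - Ic)

/-- Image of `axA = −fsN1·cA/fsN` (as `0 − fsN1·cA/fsN`). [folklore] -/
def iaxA (IΔ Ia Ib Ic Ie : NonemptyInterval ℚ) : NonemptyInterval ℚ :=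
  NonemptyInterval.pure 0 - idivPos ((ifsN1 Ia Ib Ic Ie).mooreMul (icA IΔ Ie)) (ifsN Ia Ib Ic Ie)

/-- Image of `axB = 4fsD1 + 4fsD·fsN1/fsN`. [folklore] -/
def iaxB (IΔ Ia Ib Ic Ie : NonemptyInterval ℚ) : NonemptyInterval ℚ :=
  iscale 4 (ifsD1 IΔ Ie) + idivPos ((iscale 4 (ifsD IΔ Ia Ic Ie)).mooreMul (ifsN1 Ia Ib Ic Ie)) (ifsN Ia Ib Ic Ie)

/-- Image of the nodal sum `s_node = 2x_node = fsD1/fsN1`. [folklore] -/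
def isNode (IΔ Ia Ib Ic Ie : NonemptyInterval ℚ) : NonemptyInterval ℚ := idivPos (ifsD1 IΔ Ie) (ifsN1 Ia Ib Ic Ie)

/-- Image of the face denominator `4fsD + 16fsN`. [folklore] -/
def iFaceDen (IΔ Ia Ib Ic Ie : NonemptyInterval ℚ) : NonemptyInterval ℚ :=
  iscale 4 (ifsD IΔ Ia Ic Ie) + iscale 16 (ifsN Ia Ib Ic Ie)

/-- Image of the antinodal ordinate `y_a = (cA − 4fsD)/(4fsD + 16fsN)`. [folklore] -/
def iyFace (IΔ Ia Ib Ic Ie : NonemptyInterval ℚ) : NonemptyInterval ℚ :=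
  idivPos (icA IΔ Ie - iscale 4 (ifsD IΔ Ia Ic Ie)) (iFaceDen IΔ Ia Ib Ic Ie)

/-- Image of `∂_ε charCubic` at the node: `dcharA + dcharB·s_node`. [folklore] -/
def iPn (IΔ Ia Ib Ic Ie : NonemptyInterval ℚ) : NonemptyInterval ℚ :=
  idcharA IΔ Ia Ib Ic Ie + (idcharB IΔ Ia Ib Ic Ie).mooreMul (isNode IΔ Ia Ib Ic Ie)

/-- Image of `∂_ε charCubic` at the antinode: `dcharA + dcharB·(1 + y_a)`. [folklore] -/
def iPa (IΔ Ia Ib Ic Ie : NonemptyInterval ℚ) : NonemptyInterval ℚ :=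
  idcharA IΔ Ia Ib Ic Ie + (idcharB IΔ Ia Ib Ic Ie).mooreMul (NonemptyInterval.pure 1 + iyFace IΔ Ia Ib Ic Ie)

/-- Image of `axialLin` at the antinode: `axA + axB·(1 + y_a)`. [folklore] -/
def iQa (IΔ Ia Ib Ic Ie : NonemptyInterval ℚ) : NonemptyInterval ℚ :=
  iaxA IΔ Ia Ib Ic Ie + (iaxB IΔ Ia Ib Ic Ie).mooreMul (NonemptyInterval.pure 1 + iyFace IΔ Ia Ib Ic Ie)

/-- Image of the σ form defect `δ_σ̄ = Pa/Pn − 1`. [folklore] -/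
def idelta (IΔ Ia Ib Ic Ie : NonemptyInterval ℚ) : NonemptyInterval ℚ :=
  idivPos (iPa IΔ Ia Ib Ic Ie) (iPn IΔ Ia Ib Ic Ie) - NonemptyInterval.pure 1

/-- Image of the axial-slope sensitivity `κ = Qa/Pn`. [folklore] -/
def ikappa (IΔ Ia Ib Ic Ie : NonemptyInterval ℚ) : NonemptyInterval ℚ :=
  idivPos (iQa IΔ Ia Ib Ic Ie) (iPn IΔ Ia Ib Ic Ie)

/-! ## §2 The checker -/

/-- **`fdCheck`** — the kernel-decidable point rule. Inputs: a σ one-body point `(Δ, a, b, c) = (Δ_pd, t_pd, t_pp, t_pp′)`, an energy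
piece `[e₁, e₂]` with `e₁, e₂ > 0`, claimed windows `[dlo, dhi] ∋ δ_σ̄` and `[klo, khi] ∋ κ`. A plain conjunction of rational tests.
[folklore] -/
def fdCheck (Δ a b c e₁ e₂ dlo dhi klo khi : ℚ) : Bool :=
  let IΔ := ihull Δ Δ
  let Ia := ihull a a
  let Ib := ihull b b
  let Ic := ihull c c
  let Ie := ihull e₁ e₂
  decide (0 < min e₁ e₂) && decide (0 < Δ + min e₁ e₂) && decide (0 ≤ c + b) &&
  decide (0 < (ifsN Ia Ib Ic Ie).fst) && decide (0 < (ifsD IΔ Ia Ic Ie).fst) &&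
  decide (0 < (ifsD1 IΔ Ie).fst) && decide (0 < (ifsN1 Ia Ib Ic Ie).fst) && decide (0 ≤ (icA IΔ Ie).fst) &&
  decide (0 < (iFaceDen IΔ Ia Ib Ic Ie).fst) && decide (0 < (iPn IΔ Ia Ib Ic Ie).fst) &&
  decide (dlo ≤ (idelta IΔ Ia Ib Ic Ie).fst) && decide ((idelta IΔ Ia Ib Ic Ie).snd ≤ dhi) &&
  decide (klo ≤ (ikappa IΔ Ia Ib Ic Ie).fst) && decide ((ikappa IΔ Ia Ib Ic Ie).snd ≤ khi)

/-! ## §3 Soundness -/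

/-- A rational point lies in its own cast degenerate interval. [folklore] -/
theorem mem_Icc_self_cast (q : ℚ) : ((q : ℝ)) ∈ Set.Icc (q : ℝ) q := ⟨le_refl _, le_refl _⟩

/-- **SOUNDNESS of `fdCheck`.** For every `ε` in the piece and every nodal `(x_n, x_n)` (`x_n ≥ 0`) and antinodal `(1, y_a)` point of
the contour `charCubic(·, ·, ε) = 0` of the rational σ point: the nodal energy derivative is positive, the axial coefficient vanishes
at the node, `δ_σ̄ ∈ [dlo, dhi]` and `κ ∈ [klo, khi]`. [folklore] -/
theorem formDefect_of_fdCheck {Δ a b c e₁ e₂ dlo dhi klo khi : ℚ} (h : fdCheck Δ a b c e₁ e₂ dlo dhi klo khi = true)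
    {ε xn ya : ℝ} (he : ε ∈ Set.Icc (e₁ : ℝ) e₂) (hxn : 0 ≤ xn)
    (hPn : charCubic (Δ : ℝ) a b c xn xn ε = 0) (hPa : charCubic (Δ : ℝ) a b c 1 ya ε = 0) :
    0 < dcharCubic (Δ : ℝ) a b c xn xn ε ∧ axialLin (Δ : ℝ) a b c xn xn ε = 0 ∧
      dcharCubic (Δ : ℝ) a b c 1 ya ε / dcharCubic (Δ : ℝ) a b c xn xn ε - 1 ∈ Set.Icc (dlo : ℝ) dhi ∧
      axialLin (Δ : ℝ) a b c 1 ya ε / dcharCubic (Δ : ℝ) a b c xn xn ε ∈ Set.Icc (klo : ℝ) khi := by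
  simp only [fdCheck, Bool.and_eq_true, decide_eq_true_eq] at h
  obtain ⟨⟨⟨⟨⟨⟨⟨⟨⟨⟨⟨⟨⟨he0, hΔe⟩, hcb⟩, hNq⟩, hDq⟩, hD1q⟩, hN1q⟩, hAq⟩, hFq⟩, hPnq⟩, hdlo⟩, hdhi⟩, hklo⟩, hkhi⟩ := h
  obtain ⟨mcA, mD, mN, -, mdcA, mdD, mdN⟩ :=
    mem_images (mem_Icc_self_cast Δ) (mem_Icc_self_cast a) (mem_Icc_self_cast b) (mem_Icc_self_cast c) he
  have mΔ := mem_ihull (mem_Icc_self_cast Δ)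
  have ma := mem_ihull (mem_Icc_self_cast a)
  have mb := mem_ihull (mem_Icc_self_cast b)
  have mc := mem_ihull (mem_Icc_self_cast c)
  have me := mem_ihull he
  have m0 : (0 : ℝ) ∈ (NonemptyInterval.pure (0 : ℚ)).ratCast ℝ := mem_pure_of_cast_eq (by norm_num)
  have m1 : (1 : ℝ) ∈ (NonemptyInterval.pure (1 : ℚ)).ratCast ℝ := mem_pure_of_cast_eq (by norm_num)
  have m2 : (2 : ℝ) ∈ (NonemptyInterval.pure (2 : ℚ)).ratCast ℝ := mem_pure_of_cast_eq (by norm_num)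
  have m4 : (4 : ℝ) ∈ (NonemptyInterval.pure (4 : ℚ)).ratCast ℝ := mem_pure_of_cast_eq (by norm_num)
  -- the two new images
  have mD1 : fsD1 (Δ : ℝ) ε ∈ (ifsD1 (ihull Δ Δ) (ihull e₁ e₂)).ratCast ℝ := by
    unfold fsD1 ifsD1; exact mem_ratCast_mul me (mem_ratCast_add mΔ me)
  have mN1 : fsN1 (a : ℝ) b c ε ∈ (ifsN1 (ihull a a) (ihull b b) (ihull c c) (ihull e₁ e₂)).ratCast ℝ := by
    unfold fsN1 ifsN1
    exact mem_ratCast_add (mem_ratCast_mul m4 (mem_ratCast_sq ma)) (mem_ratCast_mul (mem_ratCast_mul m2 me) (mem_ratCast_sub mb mc))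
  -- real positivity
  have hN : 0 < fsN (a : ℝ) b c ε := lt_of_lt_of_le (by exact_mod_cast hNq) (mem_ratCast_iff.mp mN).1
  have hD : 0 < fsD (Δ : ℝ) a c ε := lt_of_lt_of_le (by exact_mod_cast hDq) (mem_ratCast_iff.mp mD).1
  have hD1 : 0 < fsD1 (Δ : ℝ) ε := lt_of_lt_of_le (by exact_mod_cast hD1q) (mem_ratCast_iff.mp mD1).1
  have hN1 : 0 < fsN1 (a : ℝ) b c ε := lt_of_lt_of_le (by exact_mod_cast hN1q) (mem_ratCast_iff.mp mN1).1
  have hA : 0 ≤ cA (Δ : ℝ) ε := le_trans (by exact_mod_cast hAq) (mem_ratCast_iff.mp mcA).1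
  -- the node: axial invisibility and s_node = fsD1/fsN1
  have hε : ((min e₁ e₂ : ℚ) : ℝ) ≤ ε := (mem_ratCast_iff.mp me).1
  have hΔε : 0 < (Δ : ℝ) + ε := by
    have h1 : (0 : ℝ) < (Δ : ℝ) + ((min e₁ e₂ : ℚ) : ℝ) := by exact_mod_cast hΔe
    linarith
  have hct : 0 ≤ (c : ℝ) + b := by exact_mod_cast hcb
  obtain ⟨h2x, hax⟩ := axialLin_node_eq_zero hΔε hct hxn hPn
  have hs : xn + xn = fsD1 (Δ : ℝ) ε / fsN1 (a : ℝ) b c ε := by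
    rw [eq_div_iff hN1.ne']; linarith [h2x]
  have msn : xn + xn ∈ (isNode (ihull Δ Δ) (ihull a a) (ihull b b) (ihull c c) (ihull e₁ e₂)).ratCast ℝ := by
    rw [hs]; unfold isNode; exact mem_idivPos hN1q mD1 mN1
  -- the face point
  have m4D : (4 : ℝ) * fsD (Δ : ℝ) a c ε ∈ (iscale 4 (ifsD (ihull Δ Δ) (ihull a a) (ihull c c) (ihull e₁ e₂))).ratCast ℝ := by
    have := mem_iscale 4 mD; push_cast at this; exact this
  have m16N : (16 : ℝ) * fsN (a : ℝ) b c ε ∈ (iscale 16 (ifsN (ihull a a) (ihull b b) (ihull c c) (ihull e₁ e₂))).ratCast ℝ := by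
    have := mem_iscale 16 mN; push_cast at this; exact this
  have mFden : 4 * fsD (Δ : ℝ) a c ε + 16 * fsN (a : ℝ) b c ε ∈
      (iFaceDen (ihull Δ Δ) (ihull a a) (ihull b b) (ihull c c) (ihull e₁ e₂)).ratCast ℝ := by
    unfold iFaceDen; exact mem_ratCast_add m4D m16N
  have hFden : 0 < 4 * fsD (Δ : ℝ) a c ε + 16 * fsN (a : ℝ) b c ε := by positivity
  have hya : ya = (cA (Δ : ℝ) ε - 4 * fsD (Δ : ℝ) a c ε) / (4 * fsD (Δ : ℝ) a c ε + 16 * fsN (a : ℝ) b c ε) := by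
    rw [eq_div_iff hFden.ne']
    rw [charCubic_bilinear] at hPa
    linarith
  have mya : ya ∈ (iyFace (ihull Δ Δ) (ihull a a) (ihull b b) (ihull c c) (ihull e₁ e₂)).ratCast ℝ := by
    rw [hya]; unfold iyFace; exact mem_idivPos hFq (mem_ratCast_sub mcA m4D) mFden
  have m1ya : 1 + ya ∈ (NonemptyInterval.pure 1 + iyFace (ihull Δ Δ) (ihull a a) (ihull b b) (ihull c c) (ihull e₁ e₂)).ratCast ℝ :=
    mem_ratCast_add m1 mya
  -- the affine coefficients
  have mA : dcharA (Δ : ℝ) a b c ε ∈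
      (idcharA (ihull Δ Δ) (ihull a a) (ihull b b) (ihull c c) (ihull e₁ e₂)).ratCast ℝ := by
    unfold dcharA idcharA
    exact mem_ratCast_sub mdcA (mem_idivPos hNq (mem_ratCast_mul mdN mcA) mN)
  have mB : dcharB (Δ : ℝ) a b c ε ∈
      (idcharB (ihull Δ Δ) (ihull a a) (ihull b b) (ihull c c) (ihull e₁ e₂)).ratCast ℝ := by
    unfold dcharB idcharB
    have mneg4 := mem_iscale (-4) mdD
    push_cast at mneg4
    exact mem_ratCast_add mneg4 (mem_idivPos hNq (mem_ratCast_mul m4D mdN) mN)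
  have mXA : axA (Δ : ℝ) a b c ε ∈ (iaxA (ihull Δ Δ) (ihull a a) (ihull b b) (ihull c c) (ihull e₁ e₂)).ratCast ℝ := by
    have : (0 : ℝ) - fsN1 (a : ℝ) b c ε * cA (Δ : ℝ) ε / fsN (a : ℝ) b c ε ∈
        (iaxA (ihull Δ Δ) (ihull a a) (ihull b b) (ihull c c) (ihull e₁ e₂)).ratCast ℝ := by
      unfold iaxA; exact mem_ratCast_sub m0 (mem_idivPos hNq (mem_ratCast_mul mN1 mcA) mN)
    unfold axA; rw [neg_eq_zero_sub]; exact this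
  have mXB : axB (Δ : ℝ) a b c ε ∈ (iaxB (ihull Δ Δ) (ihull a a) (ihull b b) (ihull c c) (ihull e₁ e₂)).ratCast ℝ := by
    have m4D1 := mem_iscale 4 mD1
    push_cast at m4D1
    unfold axB iaxB
    have e : 4 * fsD (Δ : ℝ) a c ε * fsN1 (a : ℝ) b c ε / fsN (a : ℝ) b c ε
        = (4 * fsD (Δ : ℝ) a c ε) * fsN1 (a : ℝ) b c ε / fsN (a : ℝ) b c ε := by ring
    rw [e]
    exact mem_ratCast_add m4D1 (mem_idivPos hNq (mem_ratCast_mul m4D mN1) mN)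
  -- energy derivatives and the axial coefficient at the two points
  have mPn : dcharCubic (Δ : ℝ) a b c xn xn ε ∈ (iPn (ihull Δ Δ) (ihull a a) (ihull b b) (ihull c c) (ihull e₁ e₂)).ratCast ℝ := by
    rw [dcharCubic_eq_affine hN.ne' hPn]; unfold iPn; exact mem_ratCast_add mA (mem_ratCast_mul mB msn)
  have mPa : dcharCubic (Δ : ℝ) a b c 1 ya ε ∈ (iPa (ihull Δ Δ) (ihull a a) (ihull b b) (ihull c c) (ihull e₁ e₂)).ratCast ℝ := by
    rw [dcharCubic_eq_affine hN.ne' hPa]; unfold iPa; exact mem_ratCast_add mA (mem_ratCast_mul mB m1ya)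
  have mQa : axialLin (Δ : ℝ) a b c 1 ya ε ∈ (iQa (ihull Δ Δ) (ihull a a) (ihull b b) (ihull c c) (ihull e₁ e₂)).ratCast ℝ := by
    rw [axialLin_on_contour_affine hN.ne' hPa]; unfold iQa; exact mem_ratCast_add mXA (mem_ratCast_mul mXB m1ya)
  have hWn : 0 < dcharCubic (Δ : ℝ) a b c xn xn ε := lt_of_lt_of_le (by exact_mod_cast hPnq) (mem_ratCast_iff.mp mPn).1
  -- the two windows
  have mdel : dcharCubic (Δ : ℝ) a b c 1 ya ε / dcharCubic (Δ : ℝ) a b c xn xn ε - 1 ∈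
      (idelta (ihull Δ Δ) (ihull a a) (ihull b b) (ihull c c) (ihull e₁ e₂)).ratCast ℝ := by
    unfold idelta; exact mem_ratCast_sub (mem_idivPos hPnq mPa mPn) m1
  have mkap : axialLin (Δ : ℝ) a b c 1 ya ε / dcharCubic (Δ : ℝ) a b c xn xn ε ∈
      (ikappa (ihull Δ Δ) (ihull a a) (ihull b b) (ihull c c) (ihull e₁ e₂)).ratCast ℝ := by
    unfold ikappa; exact mem_idivPos hPnq mQa mPn
  rw [mem_ratCast_iff] at mdel mkap
  refine ⟨hWn, hax, ⟨?_, ?_⟩, ⟨?_, ?_⟩⟩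
  · exact le_trans (by exact_mod_cast hdlo) mdel.1
  · exact mdel.2.trans (by exact_mod_cast hdhi)
  · exact le_trans (by exact_mod_cast hklo) mkap.1
  · exact mkap.2.trans (by exact_mod_cast hkhi)

/-- **THE FOUR-ORBITAL LAW, certified form.** Under `fdCheck`, for every admixture slope `a′ ≥ 0` the four-orbital form defect of any
decomposition of the point's O–O couplings with that slope (same Fermi surface, `EmerySecularFormDefectAxial.dsec4_fixedFS`) satisfies
`W4 a′ (1, y_a)/W4 a′ (x_n, x_n) − 1 ∈ [dlo + a′·klo, dhi + a′·khi]`. [cite: AndersenEtAl1995, §7] -/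
theorem formDefect4_of_fdCheck {Δ a b c e₁ e₂ dlo dhi klo khi : ℚ} (h : fdCheck Δ a b c e₁ e₂ dlo dhi klo khi = true)
    {ε xn ya a' : ℝ} (he : ε ∈ Set.Icc (e₁ : ℝ) e₂) (hxn : 0 ≤ xn) (ha' : 0 ≤ a')
    (hPn : charCubic (Δ : ℝ) a b c xn xn ε = 0) (hPa : charCubic (Δ : ℝ) a b c 1 ya ε = 0) :
    W4 (Δ : ℝ) a b c a' 1 ya ε / W4 (Δ : ℝ) a b c a' xn xn ε - 1 ∈ Set.Icc ((dlo : ℝ) + a' * klo) (dhi + a' * khi) := by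
  obtain ⟨hWn, hax, hδ, hκ⟩ := formDefect_of_fdCheck h he hxn hPn hPa
  rw [formDefect4_linear a' hWn.ne' hax]
  constructor
  · have := mul_le_mul_of_nonneg_left hκ.1 ha'
    linarith [hδ.1]
  · have := mul_le_mul_of_nonneg_left hκ.2 ha'
    linarith [hδ.2]

/-- INVERSE READING: under `fdCheck` (`khi > 0`), a four-orbital decomposition whose form defect reaches `δt` has admixture slope at least
`(δt − dhi)/khi`. [cite: AndersenEtAl1995, §7] -/
theorem axialSlope_lower_of_fdCheck {Δ a b c e₁ e₂ dlo dhi klo khi : ℚ} (h : fdCheck Δ a b c e₁ e₂ dlo dhi klo khi = true)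
    {ε xn ya a' δt : ℝ} (he : ε ∈ Set.Icc (e₁ : ℝ) e₂) (hxn : 0 ≤ xn) (ha' : 0 ≤ a')
    (hPn : charCubic (Δ : ℝ) a b c xn xn ε = 0) (hPa : charCubic (Δ : ℝ) a b c 1 ya ε = 0) (hk : 0 < khi)
    (hR : δt ≤ W4 (Δ : ℝ) a b c a' 1 ya ε / W4 (Δ : ℝ) a b c a' xn xn ε - 1) :
    (δt - dhi) / khi ≤ a' := by
  have hup := (formDefect4_of_fdCheck h he hxn ha' hPn hPa).2
  have hk' : (0 : ℝ) < khi := by exact_mod_cast hk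
  rw [div_le_iff₀ hk']
  linarith

/-- CAP READING: under `fdCheck` (`khi ≥ 0`), every four-orbital decomposition with admixture slope `a′ ≤ acap` has form defect at most
`dhi + acap·khi`. [cite: AndersenEtAl1995, §7] -/
theorem formDefect4_le_of_cap {Δ a b c e₁ e₂ dlo dhi klo khi : ℚ} (h : fdCheck Δ a b c e₁ e₂ dlo dhi klo khi = true)
    {ε xn ya a' acap : ℝ} (he : ε ∈ Set.Icc (e₁ : ℝ) e₂) (hxn : 0 ≤ xn) (ha' : 0 ≤ a') (hcap : a' ≤ acap)
    (hPn : charCubic (Δ : ℝ) a b c xn xn ε = 0) (hPa : charCubic (Δ : ℝ) a b c 1 ya ε = 0) (hk : 0 ≤ khi) :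
    W4 (Δ : ℝ) a b c a' 1 ya ε / W4 (Δ : ℝ) a b c a' xn xn ε - 1 ≤ dhi + acap * khi := by
  have hup := (formDefect4_of_fdCheck h he hxn ha' hPn hPa).2
  have hk' : (0 : ℝ) ≤ khi := by exact_mod_cast hk
  have := mul_le_mul_of_nonneg_right hcap hk'
  linarith

end Summit.Ventures.CertifiedManyBodySolver.Downfold.Emery
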